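import Literature.Computability.AlgebraicComplexity.MatMulMonomialSubrank
import HarnessLib

/-!
# Monomial restriction and Kronecker products: `t ≥_M s, t' ≥_M s' ⇒ t ⊗ t' ≥_M s ⊗ s'`, power laws

Topic `Literature/Computability/AlgebraicComplexity`; complements `RelativeExponentProofs.lean`
(transitivity, powers, injective relabellings of monomial restriction `≥_M` =
`TensorMonRestrictsTo`, `RelativeExponent.lean`), `MatMulMonomialSubrank.lean` and
`RelativeExponentTriangle.lean` (relabellings, chains, triangle inequality) with the PRODUCT half
of the calculus; it imports only the first two. Everything in this file is PROVED over a commutative semiring.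
It is the layer behind the proof of the monomial irreversibility barrier with Schönhage
structure, Christandl–Vrana–Zuiddam Thm. 14 (`IrreversibilityBarrier.lean`, fact `CVZ2021_thm14`),
whose target tensor is a PRODUCT `⟨2⟩^{⊗α} ⊗ ⟨2,2,2⟩^{⊗β}`: the printed proof ("the proofs in the
previous sections can be directly adapted", CVZ §3.3) uses Prop. 7 (`≥_M` is a preorder
compatible with `⊗`, after Strassen 1987, §6) to multiply and rearrange monomial restrictions of
powers.

## Content

* `IsGenSubperm.kronecker` — the Kronecker product of generalised sub-permutation matrices is one;
  `TensorMonRestrictsTo.kronecker` — `≥_M` is compatible with `⊗` (the monomial analogue of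
  `TensorRestrictsTo.kronecker`, `TensorRestrictionRank.lean`, same entry identity).
* `tensorMonRestrictsTo_reindex` — relabelling along bijections, `t ≥_M t ∘ e` (the converse,
  `tensorMonRestrictsTo_of_reindex`, is in `RelativeExponentTriangle.lean`; a private copy is used
  here to keep the import light);
  `tensorMonRestrictsTo_of_subsingleton` — all-ones tensors on one-point formats (`0`-th powers).
* Power laws as pairs of mutual monomial restrictions (relabellings of coordinates):
  `t^{⊗(m+m')} ≡_M t^{⊗m} ⊗ t^{⊗m'}` (`Fin.appendEquiv`), `(s ⊗ t)^{⊗n} ≡_M s^{⊗n} ⊗ t^{⊗n}`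
  (`Equiv.arrowProdEquivProdArrow`), `t^{⊗0} ≥_M s^{⊗0}` (`t^{⊗1} ≡_M t` is in
  `RelativeExponentTriangle.lean`).
* `tensorMonRestrictsTo_matMulTensor_unitTensor_diag` — `⟨N,N,N⟩ ≥_M ⟨N⟩` (diagonal slices).
* Witness algebra for monomial costs: `tensorMonRestrictsTo_pow_mul_of_pow`
  (`t^{⊗m} ≥_M s^{⊗N} ⇒ t^{⊗(km)} ≥_M s^{⊗(kN)}`), `tensorMonRestrictsTo_pow_trans`
  (`t^{⊗m} ≥_M s`, `s^{⊗m'} ≥_M p ⇒ t^{⊗(m'm)} ≥_M p`), `tensorMonRestrictsTo_pow_add_kronecker`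
  (`t^{⊗m} ≥_M s`, `t^{⊗m'} ≥_M s' ⇒ t^{⊗(m+m')} ≥_M s ⊗ s'`).

## References

* M. Christandl, P. Vrana, J. Zuiddam, *Barriers for fast matrix multiplication from
  irreversibility*, Theory of Computing 17 (2021) = arXiv:1812.06952, §2.4, Prop. 7, §3.3.
  [ChristandlVranaZuiddam2021]
* V. Strassen, *Relative bilinear complexity and matrix multiplication*, J. reine angew. Math.
  375/376 (1987), §6 (M-restriction) — cited through CVZ §2.4.

No new notions; no domain hypothesis on `K` (`a b ≠ 0` forces `a ≠ 0` and `b ≠ 0` in any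
semiring).
-/

noncomputable section

open scoped BigOperators

namespace Literature.Computability.AlgebraicComplexity

universe u

/-! ## Products -/

section Products

variable {K : Type u} [CommSemiring K]
variable {ι κ μ ι' κ' μ' : Type*}

/-- The Kronecker product of two generalised sub-permutation matrices is a generalised
sub-permutation matrix (a nonzero product has both factors nonzero). [folklore] -/
theorem IsGenSubperm.kronecker {ι₁ ι₁' : Type*} {A : ι' → ι → K} {A₁ : ι₁' → ι₁ → K}
    (hA : IsGenSubperm A) (hA₁ : IsGenSubperm A₁) :
    IsGenSubperm (fun (x : ι' × ι₁') (y : ι × ι₁) => A x.1 y.1 * A₁ x.2 y.2) := by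
  refine ⟨fun x y₁ y₂ h₁ h₂ => Prod.ext ?_ ?_, fun y x₁ x₂ h₁ h₂ => Prod.ext ?_ ?_⟩
  · exact hA.1 _ _ _ (left_ne_zero_of_mul h₁) (left_ne_zero_of_mul h₂)
  · exact hA₁.1 _ _ _ (right_ne_zero_of_mul h₁) (right_ne_zero_of_mul h₂)
  · exact hA.2 _ _ _ (left_ne_zero_of_mul h₁) (left_ne_zero_of_mul h₂)
  · exact hA₁.2 _ _ _ (right_ne_zero_of_mul h₁) (right_ne_zero_of_mul h₂)

/-- **Monomial restriction is compatible with the tensor (Kronecker) product**: `t ≥_M s`,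
`t' ≥_M s'` imply `t ⊗ t' ≥_M s ⊗ s'` — tensor the matrices (CVZ Prop. 7: `≥_M` is a preorder
compatible with `⊗`, after Strassen 1987 §6; entry identity of `TensorRestrictsTo.kronecker`).
[cite: ChristandlVranaZuiddam2021, Prop. 7] -/
theorem TensorMonRestrictsTo.kronecker {ι₁ κ₁ μ₁ ι₁' κ₁' μ₁' : Type*} [Fintype ι] [Fintype κ]
    [Fintype μ] [Fintype ι₁] [Fintype κ₁] [Fintype μ₁] {t : ι → κ → μ → K} {s : ι' → κ' → μ' → K}
    {t' : ι₁ → κ₁ → μ₁ → K} {s' : ι₁' → κ₁' → μ₁' → K} (h : TensorMonRestrictsTo t s)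
    (h' : TensorMonRestrictsTo t' s') :
    TensorMonRestrictsTo (kroneckerTensor t t') (kroneckerTensor s s') := by
  obtain ⟨A, B, C, hA, hB, hC, hs⟩ := h
  obtain ⟨A', B', C', hA', hB', hC', hs'⟩ := h'
  refine ⟨fun x y => A x.1 y.1 * A' x.2 y.2, fun x y => B x.1 y.1 * B' x.2 y.2,
    fun x y => C x.1 y.1 * C' x.2 y.2, hA.kronecker hA', hB.kronecker hB', hC.kronecker hC',
    fun x y z => ?_⟩
  rw [kroneckerTensor_apply, hs, hs', Fintype.sum_prod_type]
  simp only [Fintype.sum_prod_type (f := fun y : κ × κ₁ => _)]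
  simp only [Fintype.sum_prod_type, kroneckerTensor_apply, Finset.mul_sum, Finset.sum_mul]
  -- LHS binders `a₁ b₁ c₁ a b c`, RHS binders `a a₁ b b₁ c c₁`
  rw [sum_comm₃, sum_interleave₃]
  refine Finset.sum_congr rfl fun a _ => Finset.sum_congr rfl fun a₁ _ =>
    Finset.sum_congr rfl fun b _ => Finset.sum_congr rfl fun b₁ _ =>
    Finset.sum_congr rfl fun c _ => Finset.sum_congr rfl fun c₁ _ => ?_
  ring

/-- Relabelling along bijections, the direction `t ≥_M t ∘ (e₁ × e₂ × e₃)` (a special case of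
`tensorMonRestrictsTo_precomp`). [folklore] -/
theorem tensorMonRestrictsTo_reindex [Fintype ι] [Fintype κ] [Fintype μ] (t : ι → κ → μ → K)
    (e₁ : ι' ≃ ι) (e₂ : κ' ≃ κ) (e₃ : μ' ≃ μ) :
    TensorMonRestrictsTo t (fun a b c => t (e₁ a) (e₂ b) (e₃ c)) :=
  tensorMonRestrictsTo_precomp t e₁.injective e₂.injective e₃.injective

/-- Local copy of `tensorMonRestrictsTo_of_reindex` (`RelativeExponentTriangle.lean`): relabelling
along bijections, the direction `t ∘ (e₁ × e₂ × e₃) ≥_M t`. [folklore] -/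
private theorem of_reindex_aux [Fintype ι] [Fintype κ] [Fintype μ] [Fintype ι']
    [Fintype κ'] [Fintype μ'] (t : ι → κ → μ → K) (e₁ : ι' ≃ ι) (e₂ : κ' ≃ κ) (e₃ : μ' ≃ μ) :
    TensorMonRestrictsTo (fun a b c => t (e₁ a) (e₂ b) (e₃ c)) t := by
  have := tensorMonRestrictsTo_precomp (fun a b c => t (e₁ a) (e₂ b) (e₃ c))
    e₁.symm.injective e₂.symm.injective e₃.symm.injective
  simpa using this

/-- On index types with at most one element every two all-ones tensors are monomial restrictions
of each other (used for `0`-th powers, `t^{⊗0} = 1` on the one-point format). [folklore] -/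
theorem tensorMonRestrictsTo_of_subsingleton [Fintype ι] [Fintype κ] [Fintype μ]
    [Subsingleton ι'] [Subsingleton κ'] [Subsingleton μ'] [Nonempty ι] [Nonempty κ] [Nonempty μ]
    {t : ι → κ → μ → K} {s : ι' → κ' → μ' → K} (ht : ∀ a b c, t a b c = 1)
    (hs : ∀ a b c, s a b c = 1) : TensorMonRestrictsTo t s := by
  obtain ⟨a₀⟩ := ‹Nonempty ι›
  obtain ⟨b₀⟩ := ‹Nonempty κ›
  obtain ⟨c₀⟩ := ‹Nonempty μ›
  have key : s = fun a b c => t ((fun _ => a₀) a) ((fun _ => b₀) b) ((fun _ => c₀) c) := by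
    funext a b c
    rw [hs, ht]
  rw [key]
  exact tensorMonRestrictsTo_precomp t (fun _ _ _ => Subsingleton.elim _ _)
    (fun _ _ _ => Subsingleton.elim _ _) (fun _ _ _ => Subsingleton.elim _ _)

end Products

/-! ## Power laws -/

section Pow

variable {K : Type u} [CommSemiring K]
variable {ι κ μ ι' κ' μ' : Type*}

/-- `t^{⊗m} ⊗ t^{⊗m'}` is `t^{⊗(m+m')}` read through `Fin.appendEquiv`. [folklore] -/
theorem kroneckerTensor_kroneckerPow_eq_append (t : ι → κ → μ → K) (m m' : ℕ) :
    kroneckerTensor (kroneckerPow t m) (kroneckerPow t m') = fun a b c =>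
      kroneckerPow t (m + m') (Fin.appendEquiv m m' a) (Fin.appendEquiv m m' b)
        (Fin.appendEquiv m m' c) := by
  funext a b c
  simp only [kroneckerTensor_apply, kroneckerPow_apply, Fin.appendEquiv_apply, Fin.prod_univ_add,
    Fin.append_left, Fin.append_right]

/-- **Splitting a power**: `t^{⊗(m+m')} ≥_M t^{⊗m} ⊗ t^{⊗m'}`. [folklore] -/
theorem tensorMonRestrictsTo_kroneckerPow_add [Fintype ι] [Fintype κ] [Fintype μ]
    (t : ι → κ → μ → K) (m m' : ℕ) :
    TensorMonRestrictsTo (kroneckerPow t (m + m'))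
      (kroneckerTensor (kroneckerPow t m) (kroneckerPow t m')) := by
  rw [kroneckerTensor_kroneckerPow_eq_append]
  exact tensorMonRestrictsTo_reindex _ _ _ _

/-- **Merging powers**: `t^{⊗m} ⊗ t^{⊗m'} ≥_M t^{⊗(m+m')}`. [folklore] -/
theorem tensorMonRestrictsTo_kroneckerPow_add' [Fintype ι] [Fintype κ] [Fintype μ]
    (t : ι → κ → μ → K) (m m' : ℕ) :
    TensorMonRestrictsTo (kroneckerTensor (kroneckerPow t m) (kroneckerPow t m'))
      (kroneckerPow t (m + m')) := by
  rw [kroneckerTensor_kroneckerPow_eq_append]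
  exact of_reindex_aux _ _ _ _

/-- `(s ⊗ t)^{⊗n}` is `s^{⊗n} ⊗ t^{⊗n}` read through `Equiv.arrowProdEquivProdArrow`. [folklore] -/
theorem kroneckerPow_kroneckerTensor_eq (s : ι → κ → μ → K) (t : ι' → κ' → μ' → K) (n : ℕ) :
    kroneckerPow (kroneckerTensor s t) n = fun a b c =>
      kroneckerTensor (kroneckerPow s n) (kroneckerPow t n)
        (Equiv.arrowProdEquivProdArrow (Fin n) (fun _ => ι) (fun _ => ι') a)
        (Equiv.arrowProdEquivProdArrow (Fin n) (fun _ => κ) (fun _ => κ') b)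
        (Equiv.arrowProdEquivProdArrow (Fin n) (fun _ => μ) (fun _ => μ') c) := by
  funext a b c
  simp only [kroneckerPow_apply, kroneckerTensor_apply, Equiv.arrowProdEquivProdArrow_apply]
  exact Finset.prod_mul_distrib

/-- **Power of a product**: `(s ⊗ t)^{⊗n} ≥_M s^{⊗n} ⊗ t^{⊗n}`. [folklore] -/
theorem tensorMonRestrictsTo_kroneckerPow_kronecker [Fintype ι] [Fintype κ] [Fintype μ]
    [Fintype ι'] [Fintype κ'] [Fintype μ'] (s : ι → κ → μ → K) (t : ι' → κ' → μ' → K) (n : ℕ) :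
    TensorMonRestrictsTo (kroneckerPow (kroneckerTensor s t) n)
      (kroneckerTensor (kroneckerPow s n) (kroneckerPow t n)) := by
  rw [kroneckerPow_kroneckerTensor_eq]
  exact of_reindex_aux _ _ _ _

/-- **Product of powers**: `s^{⊗n} ⊗ t^{⊗n} ≥_M (s ⊗ t)^{⊗n}`. [folklore] -/
theorem tensorMonRestrictsTo_kroneckerPow_kronecker' [Fintype ι] [Fintype κ] [Fintype μ]
    [Fintype ι'] [Fintype κ'] [Fintype μ'] (s : ι → κ → μ → K) (t : ι' → κ' → μ' → K) (n : ℕ) :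
    TensorMonRestrictsTo (kroneckerTensor (kroneckerPow s n) (kroneckerPow t n))
      (kroneckerPow (kroneckerTensor s t) n) := by
  rw [kroneckerPow_kroneckerTensor_eq]
  exact tensorMonRestrictsTo_reindex _ _ _ _

/-- `t^{⊗0} ≥_M s^{⊗0}` for all `t, s` (both are the scalar `1` on one-point formats). [folklore] -/
theorem tensorMonRestrictsTo_kroneckerPow_zero [Fintype ι] [Fintype κ] [Fintype μ]
    (t : ι → κ → μ → K) (s : ι' → κ' → μ' → K) :
    TensorMonRestrictsTo (kroneckerPow t 0) (kroneckerPow s 0) :=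
  tensorMonRestrictsTo_of_subsingleton (kroneckerPow_zero t) (kroneckerPow_zero s)

end Pow

/-! ## Witness algebra for monomial costs -/

section Cost

variable {K : Type u} [CommSemiring K]
variable {ι κ μ ι' κ' μ' ι'' κ'' μ'' : Type*}
variable [Fintype ι] [Fintype κ] [Fintype μ] [Fintype ι'] [Fintype κ'] [Fintype μ']

/-- Scaling a witness: `t^{⊗m} ≥_M s^{⊗N}` gives `t^{⊗(k m)} ≥_M s^{⊗(k N)}` for every `k`
(`t^{⊗(km)} ≥_M (t^{⊗m})^{⊗k} ≥_M (s^{⊗N})^{⊗k} ≥_M s^{⊗(kN)}`). [cite: ChristandlVranaZuiddam2021, §2.4] -/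
theorem tensorMonRestrictsTo_pow_mul_of_pow {t : ι → κ → μ → K} {s : ι' → κ' → μ' → K} {m N : ℕ}
    (h : TensorMonRestrictsTo (kroneckerPow t m) (kroneckerPow s N)) (k : ℕ) :
    TensorMonRestrictsTo (kroneckerPow t (k * m)) (kroneckerPow s (k * N)) :=
  (tensorMonRestrictsTo_kroneckerPow_mul_of h k).trans (tensorMonRestrictsTo_kroneckerPow_mul' s k N)

/-- Composing witnesses: `t^{⊗m} ≥_M s` and `s^{⊗m'} ≥_M p` give `t^{⊗(m' m)} ≥_M p`.
[cite: ChristandlVranaZuiddam2021, Prop. 7] -/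
theorem tensorMonRestrictsTo_pow_trans [Fintype ι''] [Fintype κ''] [Fintype μ'']
    {t : ι → κ → μ → K} {s : ι' → κ' → μ' → K} {p : ι'' → κ'' → μ'' → K} {m m' : ℕ}
    (h : TensorMonRestrictsTo (kroneckerPow t m) s) (h' : TensorMonRestrictsTo (kroneckerPow s m') p) :
    TensorMonRestrictsTo (kroneckerPow t (m' * m)) p :=
  (tensorMonRestrictsTo_kroneckerPow_mul_of h m').trans h'

omit [Fintype ι'] [Fintype κ'] [Fintype μ'] in
/-- Multiplying witnesses: `t^{⊗m} ≥_M s` and `t^{⊗m'} ≥_M s'` give `t^{⊗(m+m')} ≥_M s ⊗ s'`.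
[cite: ChristandlVranaZuiddam2021, Prop. 7] -/
theorem tensorMonRestrictsTo_pow_add_kronecker {t : ι → κ → μ → K} {s : ι' → κ' → μ' → K}
    {s' : ι'' → κ'' → μ'' → K} {m m' : ℕ} (h : TensorMonRestrictsTo (kroneckerPow t m) s)
    (h' : TensorMonRestrictsTo (kroneckerPow t m') s') :
    TensorMonRestrictsTo (kroneckerPow t (m + m')) (kroneckerTensor s s') :=
  (tensorMonRestrictsTo_kroneckerPow_add t m m').trans (h.kronecker h')

end Cost

/-! ## The diagonal of `⟨N,N,N⟩` -/

section Diagonal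

variable (K : Type u) [CommSemiring K]

/-- **`⟨N,N,N⟩ ≥_M ⟨N⟩`**: the slices `(κ,ν) = (κ,μ) = (μ,ν) = (i,i)` are an induced matching of
size `N` in the support of `⟨N,N,N⟩` (diagonal matrices multiply entrywise); in particular
`⟨2,2,2⟩ ≥_M ⟨2⟩`, so a monomial path to `⟨2,2,2⟩` is one to `⟨2⟩`. [folklore] -/
theorem tensorMonRestrictsTo_matMulTensor_unitTensor_diag (N : ℕ) :
    TensorMonRestrictsTo (matMulTensor K N N N) (unitTensor K N) := by
  have hinj : Function.Injective fun i : Fin N => (i, i) := fun i j h => (Prod.ext_iff.1 h).1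
  refine tensorMonRestrictsTo_unitTensor_of_diagonal K (matMulTensor K N N N) (fun i => (i, i))
    (fun i => (i, i)) (fun i => (i, i)) hinj hinj hinj (fun d₁ d₂ d₃ => ?_) (Fintype.card_fin N)
  simp only [matMulTensor]
  exact if_congr ⟨fun ⟨h₁, h₂, _⟩ => ⟨h₁, h₂⟩, fun ⟨h₁, h₂⟩ => ⟨h₁, h₂, h₁.trans h₂⟩⟩ rfl rfl

end Diagonal

end Literature.Computability.AlgebraicComplexity

end
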